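import Summits.CriticalPhenomena.PercolationContinuityZ3.Theorems.PercNearOneGluingNoHeavyLowerTailSahiC3CubeColourCheck

/-!
# Kahn's Conjecture 5 on `{0,1}^5`: the coloured-antichain check, chunk B2 (first point `q' = 7`, colour 2) — COMPUTATIONAL (`native_decide`)

Support file (cell `prim-sahi`, seat `prim-sahi-typer` gen 27; `--supports stmt-CriticalPhenomena-4575`; COMPUTATIONAL).  One piece of the
evaluation of `colourCheck 5 19` (…`SahiC3CubeColourCheck`): the colour-2 branch of `goCC` for the antichains whose first point is `q' = 7`.  The gate's elaboration budget is 600 s and the whole check takes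
≈ 25 min of compiled evaluation, so it is split along the skip chain of `goCC` by the FIRST chosen point `q'` of the antichain (work shares:
`q' = 3`: 33.8 % (chunk A, landed), `q' = 7`: 33.8 % (chunks B0–B2, one per colour of the first point), `q' = 5`: 13.2 % (C1), `q' ∈ {6, 11}`: 12.9 % (C2),
the rest 6.3 % (C3)); the pieces are assembled in …`SahiC3CubeFive` (`colourCheck_of_branches`). [this work]
-/

namespace Summit.CriticalPhenomena.PercolationContinuityZ3.Theorems.SahiC3Cube

open OneCutCert CovTransferCert

/-- Chunk B2 of `colourCheck 5 19`: first point `7` takes colour `2` (compiled evaluation, ≈ 11 % of the total work). [this work] -/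
theorem colourChunk_five_b2 :
    goCC 19 5 (krT 19 5 (fullN 5)) (offT 19 5) (offT 19 5).toNat (2 ^ 5 - (7 + 1)) (7 + 1) (0 ||| coneN 5 7) 0 0 (0 ||| belowN 5 7) = true := by
  native_decide

end Summit.CriticalPhenomena.PercolationContinuityZ3.Theorems.SahiC3Cube
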